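import Mathlib
import HarnessLib
import HarnessLib.Audit
import Summits.MatrixMultiplication.Statement
import Literature.Computability.AlgebraicComplexity.MatrixMultiplicationExponent
import Literature.Computability.AlgebraicComplexity.FlatteningBound
import Literature.Computability.AlgebraicComplexity.SchoenhageTau
import Literature.Computability.AlgebraicComplexity.SchoenhageTauBini
import Literature.Computability.AlgebraicComplexity.BorderRankFlattening
import HarnessLib.Audit.Status.Attr

/-!
Route: MarginalColumns

DORMANT since 2026-08-24T06:57:57Z (reconciler: no traction for 6.6 d (last activity item-evidence-added at 2026-08-17T16:37:52Z); parked, not closed — `ledger route dormant route-MatrixMultiplication-MarginalColumns --off` to reactivat) — unstaffed, not closed; items shared with open routes are served there. `ledger route dormant <id> --off` reactivates.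

# Route MarginalColumns — omega = 2 one column at a time — the second column of the border tower is
the dearest, and it is cheap

TRANSFER route (lens: the solved/near-solved border-rank tower of the 2×2 case). Write T_n(w) :=
bR⟨n,n,w⟩ =
algBorderRank (matMulTensor ℂ n n w), the border rank of an n×n matrix times an n×w matrix — the
COLUMN TOWER of the square
format (T_n(1) = n², T_n(n) = bR⟨n,n,n⟩; by Koszul flattening T_n(w) ≥ (2n−1)w,
LandsbergOttaviani2015). It suffices to show
X = D ∧ C. D (SECOND COLUMN DOMINATES): no later column costs more than the second one, T_n(w+1) −
T_n(w) ≤ T_n(2) − T_n(1)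
for all n, w ≥ 1. C (SECOND COLUMN CHEAP): the second column costs n^{1+o(1)}, i.e. bR⟨n,n,2⟩ ≤ n² +
C_ε n^{1+ε}. Then
T_n(n) ≤ n² + (n−1)(T_n(2) − n²) = O(n^{2+ε}) for every ε, and Bini's inequality n^ω ≤ bR⟨n,n,n⟩
gives ω(ℂ) = 2. The exact
model behind both is the hollow-schoolbook law bR⟨a,b,c⟩ = abc − (a−1)(b−1)(c−1) (card
hollow-schoolbook-law, realised here
in its weakest closing form): T_n(w) = n² + (2n−1)(w−1), every marginal equal to the Koszul slope
2n−1 from the second column on.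
Lean: `(∀ n w : ℕ, 1 ≤ n → 1 ≤ w → Literature.Computability.AlgebraicComplexity.algBorderRank
(Literature.Computability.AlgebraicComplexity.matMulTensor ℂ n n (w + 1)) +
Literature.Computability.AlgebraicComplexity.algBorderRank
(Literature.Computability.AlgebraicComplexity.matMulTensor ℂ n n 1) ≤
Literature.Computability.AlgebraicComplexity.algBorderRank
(Literature.Computability.AlgebraicComplexity.matMulTensor ℂ n n w) +
Literature.Computability.AlgebraicComplexity.algBorderRank
(Literature.Computability.AlgebraicComplexity.matMulTensor ℂ n n 2)) ∧ (∀ ε : ℝ, 0 < ε → ∃ C : ℝ, ∀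
n : ℕ, 1 ≤ n → (Literature.Computability.AlgebraicComplexity.algBorderRank
(Literature.Computability.AlgebraicComplexity.matMulTensor ℂ n n 2) : ℝ) ≤ (n : ℝ) ^ 2 + C * (n : ℝ)
^ (1 + ε))`

## Assembly
Forty lines of arithmetic over the tree (sorry-free in Sketch.lean and glue.lean, axioms standard):
D gives by induction on w the
subtraction-free tower bound T_n(w) + (w−1)·T_n(1) ≤ T_n(1) + (w−1)·T_n(2); T_n(1) = n² (border-rank
flattening:
card_le_algBorderRank_of_linearIndependent with linearIndependent_rotate_matMulTensor and
algBorderRank_rotate, below; tensorRank_matMulTensor_le, above); with C this is bR⟨n,n,n⟩ ≤ n² +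
(n−1)·C n^{1+ε/2} ≤ (1 + C)n^{2+ε/2}; Bini's single-block inequality
n^ω ≤ bR⟨n,n,n⟩ (from Blaser2013_thm66_holds — Bläser 2013 Thm 6.6 = Bini 1980, PROVED in tree — via
Real.rpow_logb, for n ≥ 2) then forces
ω ≤ 2 + ε/2 for every ε (n^{ω−2−ε/2} bounded), so ω ≤ 2; 2 ≤ ω is omega_two_le; ω(ℂ) = 2 is
MatrixMultiplication_iff.

Rationale: WHY THIS LINE. SIBLING (solved/border case, payload): the tower bR⟨m,2,2⟩ = 4, 7, 10, then ≤ 13, ≤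
16, …, 3m ≤ · ≤ 3m + ⌈m/7⌉ (Landsberg2005;
ConnerHarperLandsberg2023 Thm 1.3; LandsbergRyder2015 §3 Prop 3.1–3.2; LandsbergGCT2017 §4.8 pp.
105–109; Smirnov2015), with the
expected exact law 3m+1 ("we expect equality to hold for all n", ConnerHarperLandsberg2023 p. 4).
Its winning mechanism is MARGINAL
ECONOMY: every new row is bought for exactly 3 = 7 − 4, realised by gluing reduced tensors
(BiniEtAl1979 bR(M^red_2) = 5,
AlekseevSmirnov2013 bR(M^red_3) = 8, LandsbergRyder2015 Prop 3.1: bR⟨m+m'−1,2,2⟩ ≤ bR(M^red_m) +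
bR(M^red_m')). PORT to the square
tower T_n(w): step 1 (subadditivity over a split shared column) transfers verbatim; step 2 (a
reduced piece that saves on its partial
column) is TIGHT at n = 2 (5 + 5 = 10) and PROVABLY LOSSY at n = 3: in any two-piece split of
⟨3,3,3⟩ along a shared row, the piece
keeping a full ⟨1,3,3⟩ costs ≥ 9 (flattening) and the other ≥ 14 − 3k (subadditivity from
ConnerHarperLandsberg2023 Thm 1.4,
bR⟨2,3,3⟩ = 14, after deleting k ∈ {1,2} rank-3 slices), total ≥ 20 > 19 — so from n = 3 on marginal
economy needs NON-additive
absorption (new ε-structure shared across the split; the missing item K3 of card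
hollow-schoolbook-law). The route files the two
invariants that marginal economy must satisfy whatever its mechanism: D (diminishing returns, the
shadow of concavity of w ↦ T_n(w))
and C (the one step with no sibling analogue: at n = 2 the first marginal is the finite fact 7 − 4 =
3; for general n it is the
all-n statement bR⟨n,n,2⟩ − n² = n^{1+o(1)}, known only to lie between 1.32n + 1
(ConnerHarperLandsberg2023 Thm 1.4(3), border
apolarity) and n²/2 + n/2 (HopcroftKerr1971, rank of ⟨n,2,n⟩)). Imported area: amortised / module
complexity read at FINITE width
(Landsberg–Michałek's factorisation M_⟨n,n,w⟩ = M_⟨n,n,1⟩ ⊗ Id_w, LandsbergMichalek2018 Thm 1.1, is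
the lower-bound face of the same
tower) and discrete convexity along a chain. What no listed route does: EPRFaces and
ShapeSubmodularity read the tower only at w = n^k,
k → ∞ (exponent ω(1,1,k), perfect amortisation E) or across incomparable formats (exchange axiom
SUBMOD); here the lever is the
marginal cost of the FIRST n columns at exact border rank, where ω = 2 itself says nothing (blocking
gives only bR⟨n,n,w⟩ ≤ C n² w^ε)
and where the sibling tower is actually solved. Negatives index (6 refuted statements, all
STPP/design side): untouched.

RANKED CRUXES. #0 Thesis (target) — X = SecondColumnDominates ∧ SecondColumnCheap (card
hollow-schoolbook-law in its weakest closing form). (why it might fail: marginal economy may simply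
not exist beyond n = 2: bR⟨3,3,3⟩ = 20 kills D at its first cell, and a border rank bR⟨n,n,2⟩ ≥
(1+c)n² (bulk-only economy) kills C without touching ω = 2.) [LandsbergGCT2017,
ConnerHarperLandsberg2023, LandsbergRyder2015, HopcroftKerr1971]
#2 SecondColumnCheap (crux) — C — the second column is cheap: for every ε > 0 there is C with
bR⟨n,n,2⟩ ≤ n² + C·n^{1+ε} for all n ≥ 1 (the hollow law predicts exactly n² + 2n − 1: 7, 14, 23, …;
the border rank of a rank-two update exceeds that of a rank-one update by n^{1+o(1)} only).
[difficulty: open-problem] (why it might fail: no infinite family below (3n²+n)/2 (HopcroftKerr1971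
rank of ⟨n,2,n⟩; 7n²/4 by ⟨2,2,2⟩⊠⟨1,n/2,n/2⟩) is known; the law's cells hold at n = 2, 3 (7, 14)
but NazarovSmirnov2023 stop at 24 = 16 + 8 for ⟨2,4,4⟩ (law 23); economy may be bulk-only, bR⟨n,n,2⟩
~ (1+c)n².) [ConnerHarperLandsberg2023, HopcroftKerr1971, NazarovSmirnov2023, Smirnov2013,
LandsbergGCT2017]
#3 SecondColumnDominates (crux) — D — the second column is the dearest: T_n(w+1) + T_n(1) ≤ T_n(w) +
T_n(2) for all n, w ≥ 1 (every marginal of the column tower is at most the first one; the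
subtraction-free shadow of concavity of w ↦ bR⟨n,n,w⟩). At n = 2 it is Landsberg's expected tower
bR⟨m,2,2⟩ ≤ 3m + 1 (support TwoTowerAffine); at n = 3, w = 2 it is exactly bR⟨3,3,3⟩ ≤ 19.
[difficulty: open-problem] (why it might fail: its first open cell is bR⟨3,3,3⟩ ≤ 19 (window
[17,20]: ConnerHarperLandsberg2023 Thm 1.1, Smirnov2013); numerical searches since 2013 stop at 20;
rank towers are NOT monotone in marginals (R⟨2,2,w⟩ = 4, 7, 11: 3 then 4), only border rank is
expected to be.) [LandsbergGCT2017, ConnerHarperLandsberg2023, Smirnov2013, LandsbergRyder2015,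
AlekseevSmirnov2013]
#9 TowerConcavity (support) — the natural parent of D: w ↦ bR⟨n,n,w⟩ is concave, T_n(w+2) + T_n(w) ≤
2·T_n(w+1) for all n, w ≥ 1 (diminishing returns). With the Koszul bound T_n(w) ≥ (2n−1)w it forces
every marginal ≥ 2n−1, hence bR⟨n,n,n⟩ ≥ 3n² − 3n + 1 (the hollow lower half, far beyond 2n² − log₂n
− 1) — recorded as the STRONG form; D is what the assembly needs. [difficulty: open-problem]
[LandsbergGCT2017, LandsbergOttaviani2015, LandsbergMichalek2018]
#9 ConcavityDominates (support) — TowerConcavity → SecondColumnDominates (induction on w; proved in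
the planner's Sketch.lean). [difficulty: provable-now] [LandsbergGCT2017]
#9 UniformAmortisation (support) — the asymptotic content of D ∧ C and the fallback thesis if D dies
at one cell: each of the first n columns costs n^{1+o(1)} — for every ε > 0 there is C with
bR⟨n,n,w⟩ ≤ n² + C·w·n^{1+ε} for all 1 ≤ w ≤ n. Strictly finer than ω = 2 in the thin regime
(blocking from ω = 2 gives only C n² w^ε); implies EPRFaces' perfect amortisation E. [difficulty:
open-problem] [LandsbergMichalek2018, ConnerHarperLandsberg2023]
#9 AmortisationOfCruxes (support) — SecondColumnDominates → SecondColumnCheap → UniformAmortisation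
(the tower bound T_n(w) ≤ n² + (w−1)(T_n(2) − n²); proved in the planner's Sketch.lean).
[difficulty: provable-now] [LandsbergGCT2017]
#9 CubeNineteen (support) — the first open cell of D and the route's cheapest falsifier: bR⟨3,3,3⟩ ≤
19 over ℂ[ε] (printed window [17, 20]; in tree 17 ≤ · ≤ 20 proved). Shared verbatim with route
ShapeSubmodularity's support CubeNineteen. [difficulty: L] [Smirnov2013, ConnerHarperLandsberg2023,
LandsbergGCT2017]
#9 CubeNineteenOfDominates (support) — D → bR⟨3,3,3⟩ ≤ 19 (D at n = 3, w = 2 with the tree's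
bR⟨3,2,3⟩ ≤ 14 rotated and 9 ≤ bR⟨3,3,1⟩; proved in the planner's Sketch.lean) — records that
bR⟨3,3,3⟩ = 20 refutes D. [difficulty: provable-now] [Smirnov2013, ConnerHarperLandsberg2023]
#9 TwoTowerAffine (support) — D → bR⟨2,2,w⟩ ≤ 3w + 1 for all w ≥ 1 — the sibling tower's expected
law (LandsbergGCT2017 §4.8, LandsbergRyder2015 §3) is D at n = 2 (from bR⟨2,2,2⟩ ≤ 7, Strassen, in
tree; proved in the planner's Sketch.lean). [difficulty: provable-now] [LandsbergGCT2017,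
LandsbergRyder2015, Smirnov2015]
#9 SecondColumnGrowth (support) — the negative side of C (bulk-only economy): there is c > 0 with
bR⟨n,n,2⟩ ≥ (1 + c)n² for all large n — an all-n border-apolarity target for ⟨2,n,n⟩ in the style of
ConnerHarperLandsberg2023 Thm 1.4(3); it refutes C and the route (not the summit). [difficulty:
open-problem] [ConnerHarperLandsberg2023, LandsbergMichalek2018]

TWO-LAYER PLAN. SecondColumnDominates ⇐ TowerConcavity (filed as support; glue ConcavityDominates) —
attacked cell by cell: CubeNineteen first
(bR⟨3,3,3⟩ ∈ {17,…,20} vs 19, the tree's Borel-fixed border-apolarity pipeline from below,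
structured scheme search from above),
then bR⟨2,2,4⟩ = 13 and the ⟨4,4,w⟩ tower (16, [22,24], ·, [29,46]). SecondColumnCheap ⇐ an explicit
uniform family of border
schemes for ⟨n,n,2⟩ with n² + O(n) terms (Landsberg–Ryder-type geometric families / Borel-fixed
normal forms, LandsbergMichalek2018)
→ SecondColumnCheap; or ⇐ the law's cells bR⟨n,n,2⟩ = n² + 2n − 1 for n = 4, 5 (23, 34) as data.
UniformAmortisation is the
re-entry point if D is refuted at a single cell (file its o-slack form then).

KILL CRITERIA. bR⟨3,3,3⟩ = 20 (¬CubeNineteen, e.g. the tree's apolarity pipeline at r = 19) refutes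
SecondColumnDominates (CubeNineteenOfDominates)
and TowerConcavity: close `refuted:SecondColumnDominates` unless the tenure planner re-files the
slack form through UniformAmortisation
(new item, new glue). SecondColumnGrowth proved (or any bR⟨n,n,2⟩ ≥ n² + n^{1+δ} infinitely often)
refutes SecondColumnCheap and the
marginal-economy thesis outright: close `refuted:SecondColumnCheap`; the summit survives (ω = 2 does
not imply C). An exact value
bR⟨2,2,w⟩ ≤ 3w for some w ≥ 2 refutes TowerConcavity (with the Koszul bound) but not D. ω = 2 proved
elsewhere moots the route
(D, C stay open as structure statements).

NOT DECOMPOSED YET. The absorption mechanism itself (how a border scheme for ⟨n,n,w⟩ absorbs the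
(n−1)² interior products of a new column at cost 2n−1
— card hollow-schoolbook-law K3); the lower half of the law (TowerConcavity ⇒ bR⟨n,n,n⟩ ≥ 3n² − 3n +
1, a lower-bound programme
of its own); the non-square towers ⟨a,b,w⟩ (NazarovSmirnov2023's ⟨2,n,4⟩ ≤ 6n, law 5n + 3); the
general inflation question "is
w ↦ bR(S ⊠ Id_w) concave for every tensor S" (false for rank, open for border rank); continuity in ε
of the constant C.

CHEAPEST FALSIFIER. bR⟨3,3,3⟩ versus 19: the tree already certifies 17 ≤ bR⟨3,3,3⟩ ≤ 20
(BorderRankMatMulThreeSeventeen, BorderRankMatMulThreeSmirnov);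
running the Borel-fixed border-apolarity kernel test at r = 18, 19 (ConnerHarperLandsberg2023 §6–7
style, the tree's
BorderRankMatMulThree* pipeline) either kills D (no candidate survives at 19 ⇒ bR = 20) or leaves
survivors to be excluded/realised.
Not runnable inside this planning session (multi-day certified enumeration); the second cheapest is
the cell bR⟨2,4,4⟩ ∈ {22, 23, 24}
(ConnerHarperLandsberg2023 Thm 1.4(2) table: ≥ 22; NazarovSmirnov2023: ≤ 24; law and
first-marginal-equals-Koszul-slope: 23).

NUMBERS. Sibling tower bR⟨m,2,2⟩: 4, 7, 10 exact; ≤ 13, ≤ 16, …, 3m ≤ · ≤ 3m + ⌈m/7⌉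
(LandsbergRyder2015 §3; Smirnov2015: ⟨7,2,2⟩ ≤ 22);
expected 3m + 1. Square towers: T_3 = 9, 14, [17,20], [21, ·] (LandsbergMichalek2018 Thm 1.1 at n =
3, w = 4); T_4 = 16, [22,24]
(ConnerHarperLandsberg2023 Thm 1.4(2), NazarovSmirnov2023), ·, [29,46] (LandsbergMichalek2018;
Smirnov arXiv:1412.1687). Hollow law
P(a,b,c) = abc − (a−1)(b−1)(c−1): T_n(w) = n² + (2n−1)(w−1), cubes 3n² − 3n + 1 = 7, 19, 37, 61;
first marginals 3, 5, 7, 9.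
Bounds on the first marginal bR⟨n,n,2⟩ − n²: ≥ 1.32n + 1 for n ≥ 25 and 6, 7, 8, 9, 11, … for n =
4..8 (ConnerHarperLandsberg2023
Thm 1.4); ≤ n²/2 + n/2 (HopcroftKerr1971, ⌈(3pn + max(p,n))/2⌉ at p = n); ≤ 3n²/4 for even n
(Kronecker with ⟨2,2,2⟩).
Koszul slope: T_n(w) ≥ (2n−1)w (LandsbergOttaviani2015 = LandsbergGCT2017 Thm 2.5.2.6). Items at
open: 12 (2 cruxes).

DEFINITION REQUESTS. None: algBorderRank, matMulTensor, omega and the Bini/flattening lemmas exist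
in Literature.Computability.AlgebraicComplexity
(SchoenhageTau, SchoenhageTauBini, BorderRankFlattening, MatrixMultiplicationExponent,
FlatteningBound — rev 1 cone repair
dropped the over-broad import CoppersmithWinograd1982Crude: module cone 28 → 12 project modules,
every Literature constant the file uses is proved). Acquisition filed: acq-06231
(NazarovSmirnov2023 full text, for the ⟨2,n,4⟩ schemes and the ⟨2,4,4⟩ @ 24 construction).

Novelty: Searches (2026-08-16): `lit search --source zbmath "border rank matrix multiplication"` (25 rows:
LandsbergOttaviani2015, LandsbergMichalek2018, arXiv:1601.08229, LandsbergRyder2015, Lickteig 1984,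
Landsberg surveys 2008/2022, ConnerHarperLandsberg2023, Bläser–Lysikov …); `lit search --source
zbmath "approximate bilinear algorithm matrices Smirnov length"` + `"Smirnov bilinear complexity
matrix multiplication"` (8 rows: Smirnov2013, Smirnov2015, AlekseevSmirnov2013, Alekseev 2015
Chebyshevskiĭ Sb., NazarovSmirnov2023, Nazarov 2023, Trefilov 2014, arXiv:1412.1687); `lit search
--source crossref "Nazarov Smirnov approximate bilinear complexity …"` (10 rows); `lit galaxy search
"border rank of matrix multiplication" --star pdf` (13 rows: Landsberg Trieste survey 2022, CGLVW,
EGOW18, Michałek–Landsberg hay …); `lit galaxy search … --star all` on "n x 2 by 2 x 2" phrases (0);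
held texts read: LandsbergGCT2017 pp. 31, 47, 105–109, 132–134; LandsbergRyder2015 §3;
ConnerHarperLandsberg2023 §1 (Thm 1.4, 1.5, Rem 1.8); HopcroftKerr1971 and NazarovSmirnov2023
abstracts (publisher pages); tree files BorderRankMatMulSmall*, BorderRankMatMulThree*,
CoppersmithWinograd1982Crude, SchoenhageTau; hub: all 54 open route headers, EPRFaces and
ShapeSubmodularity in full, cards hollow-schoolbook-law, shape-submodularity-border-mrr2,
epr-faces-amortised-module-border-rank, streams-hit-landsberg-ottaviani,
border-apolarity-square-all-n, the 127 closed card titles; searchd/OpenAlex/S2 down this sessi  [refs: 1601.08229, 1412.1687, LandsbergOttaviani2015, LandsbergMichalek2018, LandsbergRyder2015, ConnerHarperLandsberg2023, Smirnov2013, Smirnov2015, AlekseevSmirnov2013, NazarovSmirnov2023, LandsbergGCT2017, HopcroftKerr1971]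

Barriers (technique_class: border-rank-small-formats, format-induction): - technique_class: border-rank-small-formats, format-induction
- Literature.Barriers.MatrixMultiplication.InfimumNotMinimumBarrier: respected and illustrated — no
single format certifies its exponent (log_n(3n² − 3n + 1) > 2 for every n); D ∧ C certify ω = 2 only
through the whole tower, one direct border scheme per format, never a fixed basic algorithm powered
up.
- Literature.Barriers.MatrixMultiplication.IrreversibilityBarrier: not in class — there is no
intermediate tensor whose powers are degenerated; each ⟨n,n,w⟩ gets its own border scheme (as BCLR,
Alekseev–Smirnov, Smirnov produce them).
- Literature.Barriers.MatrixMultiplication.UniversalMethodBarrier: not in class for the same reason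
(no T-method, no monomial degeneration of powers of a fixed tensor).
- Literature.Barriers.MatrixMultiplication.UnstableTensorBarrier: not in class (no
minimal-border-rank carrier; the schemes are for the matrix multiplication formats themselves).
- Literature.Barriers.MatrixMultiplication.RectangularBarrier: not in class — the thin formats
⟨n,n,w⟩, w ≤ n, enter through their exact border ranks, not through a CW_q T-method bound on ω(p);
the barrier's α ≤ 0.625-type ceilings concern fixed-tensor methods only.
- Literature.Barriers.MatrixMultiplication.LinearRankMethodBarrier: relevant only to REFUTING the
cruxes, and no obstruction there: the decisive cells (20 at ⟨3,3,3⟩, n² + n^{1+δ} at ⟨2,n,n⟩) lie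
far below the cactus caps 6·9 − 4 = 50 and 2(n² + 4n − 2); border apolarity (ConnerHar

History (route lifecycle, newest last):
- 2026-08-24T06:57:57Z · DORMANT — reconciler: no traction for 6.6 d (last activity item-evidence-added at 2026-08-17T16:37:52Z); parked, not closed — `ledger route dormant route-MatrixMultiplica (operator:999:3865185)

sub-problem: MatrixMultiplication · status: dormant · opened planner-plan-lens-MatrixMultiplication-transfer-v2-g2-0 2026-08-16T16:32:05Z · rev 2 · ledger route-MatrixMultiplication-MarginalColumns
GENERATED by the gate from the ledger (D-0016/17). Provers cite these decls: `theorem foo : Summit.MatrixMultiplication.MatrixMultiplication.Theses.MarginalColumns.<Decl> := …` in Summits/MatrixMultiplication/MatrixMultiplication/Theorems/<Name>.lean.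
-/

namespace Summit.MatrixMultiplication.MatrixMultiplication.Theses.MarginalColumns

open scoped BigOperators Topology Manifold Classical MeasureTheory ProbabilityTheory Matrix InnerProductSpace ComplexConjugate ContinuousMap
open Filter Set Function TopologicalSpace MeasureTheory

attribute [summit_statement] _root_.MatrixMultiplication

/-- item stmt-MatrixMultiplication-16308 · target · rank 0 · open · by planner
why it might fail: marginal economy may simply not exist beyond n = 2: bR⟨3,3,3⟩ = 20 kills D at its first cell, and a border rank bR⟨n,n,2⟩ ≥ (1+c)n² (bulk-only economy) kills C without touching ω = 2.
sources: LandsbergGCT2017, ConnerHarperLandsberg2023, LandsbergRyder2015, HopcroftKerr1971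
[target] X = SecondColumnDominates ∧ SecondColumnCheap (card hollow-schoolbook-law in its weakest
closing form). -/
@[route_item "route-MatrixMultiplication-MarginalColumns"]
def Thesis : Prop :=
  (∀ n w : ℕ, 1 ≤ n → 1 ≤ w → Literature.Computability.AlgebraicComplexity.algBorderRank (Literature.Computability.AlgebraicComplexity.matMulTensor ℂ n n (w + 1)) + Literature.Computability.AlgebraicComplexity.algBorderRank (Literature.Computability.AlgebraicComplexity.matMulTensor ℂ n n 1) ≤ Literature.Computability.AlgebraicComplexity.algBorderRank (Literature.Computability.AlgebraicComplexity.matMulTensor ℂ n n w) + Literature.Computability.AlgebraicComplexity.algBorderRank (Literature.Computability.AlgebraicComplexity.matMulTensor ℂ n n 2)) ∧ (∀ ε : ℝ, 0 < ε → ∃ C : ℝ, ∀ n : ℕ, 1 ≤ n → (Literature.Computability.AlgebraicComplexity.algBorderRank (Literature.Computability.AlgebraicComplexity.matMulTensor ℂ n n 2) : ℝ) ≤ (n : ℝ) ^ 2 + C * (n : ℝ) ^ (1 + ε))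

/-- item stmt-MatrixMultiplication-16309 · crux · rank 2 · open · by planner
why it might fail: no infinite family below (3n²+n)/2 (HopcroftKerr1971 rank of ⟨n,2,n⟩; 7n²/4 by ⟨2,2,2⟩⊠⟨1,n/2,n/2⟩) is known; the law's cells hold at n = 2, 3 (7, 14) but NazarovSmirnov2023 stop at 24 = 16 + 8 for ⟨2,4,4⟩ (law 23); economy may be bulk-only, bR⟨n,n,2⟩ ~ (1+c)n².
sources: ConnerHarperLandsberg2023, HopcroftKerr1971, NazarovSmirnov2023, Smirnov2013, LandsbergGCT2017
[crux] C — the second column is cheap: for every ε > 0 there is C with bR⟨n,n,2⟩ ≤ n² + C·n^{1+ε}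
for all n ≥ 1 (the hollow law predicts exactly n² + 2n − 1: 7, 14, 23, …; the border rank of a
rank-two update exceeds that of a rank-one update by n^{1+o(1)} only). [difficulty: open-problem] -/
@[route_item "route-MatrixMultiplication-MarginalColumns", crux]
def SecondColumnCheap : Prop :=
  ∀ ε : ℝ, 0 < ε → ∃ C : ℝ, ∀ n : ℕ, 1 ≤ n → (Literature.Computability.AlgebraicComplexity.algBorderRank (Literature.Computability.AlgebraicComplexity.matMulTensor ℂ n n 2) : ℝ) ≤ (n : ℝ) ^ 2 + C * (n : ℝ) ^ (1 + ε)

/-- item stmt-MatrixMultiplication-16310 · crux · rank 3 · open · by planner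
why it might fail: its first open cell is bR⟨3,3,3⟩ ≤ 19 (window [17,20]: ConnerHarperLandsberg2023 Thm 1.1, Smirnov2013); numerical searches since 2013 stop at 20; rank towers are NOT monotone in marginals (R⟨2,2,w⟩ = 4, 7, 11: 3 then 4), only border rank is expected to be.
sources: LandsbergGCT2017, ConnerHarperLandsberg2023, Smirnov2013, LandsbergRyder2015, AlekseevSmirnov2013
[crux] D — the second column is the dearest: T_n(w+1) + T_n(1) ≤ T_n(w) + T_n(2) for all n, w ≥ 1
(every marginal of the column tower is at most the first one; the subtraction-free shadow of
concavity of w ↦ bR⟨n,n,w⟩). At n = 2 it is Landsberg's expected tower bR⟨m,2,2⟩ ≤ 3m + 1 (support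
TwoTowerAffine); at n = 3, w = 2 it is exactly bR⟨3,3,3⟩ ≤ 19. [difficulty: open-problem] -/
@[route_item "route-MatrixMultiplication-MarginalColumns", crux]
def SecondColumnDominates : Prop :=
  ∀ n w : ℕ, 1 ≤ n → 1 ≤ w → Literature.Computability.AlgebraicComplexity.algBorderRank (Literature.Computability.AlgebraicComplexity.matMulTensor ℂ n n (w + 1)) + Literature.Computability.AlgebraicComplexity.algBorderRank (Literature.Computability.AlgebraicComplexity.matMulTensor ℂ n n 1) ≤ Literature.Computability.AlgebraicComplexity.algBorderRank (Literature.Computability.AlgebraicComplexity.matMulTensor ℂ n n w) + Literature.Computability.AlgebraicComplexity.algBorderRank (Literature.Computability.AlgebraicComplexity.matMulTensor ℂ n n 2)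

/-- item stmt-MatrixMultiplication-16311 · support · rank 9 · open · by planner
sources: LandsbergGCT2017, LandsbergOttaviani2015, LandsbergMichalek2018
[support] the natural parent of D: w ↦ bR⟨n,n,w⟩ is concave, T_n(w+2) + T_n(w) ≤ 2·T_n(w+1) for all
n, w ≥ 1 (diminishing returns). With the Koszul bound T_n(w) ≥ (2n−1)w it forces every marginal ≥
2n−1, hence bR⟨n,n,n⟩ ≥ 3n² − 3n + 1 (the hollow lower half, far beyond 2n² − log₂n − 1) — recorded
as the STRONG form; D is what the assembly needs. [difficulty: open-problem] -/
@[route_item "route-MatrixMultiplication-MarginalColumns"]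
def TowerConcavity : Prop :=
  ∀ n w : ℕ, 1 ≤ n → 1 ≤ w → Literature.Computability.AlgebraicComplexity.algBorderRank (Literature.Computability.AlgebraicComplexity.matMulTensor ℂ n n (w + 2)) + Literature.Computability.AlgebraicComplexity.algBorderRank (Literature.Computability.AlgebraicComplexity.matMulTensor ℂ n n w) ≤ 2 * Literature.Computability.AlgebraicComplexity.algBorderRank (Literature.Computability.AlgebraicComplexity.matMulTensor ℂ n n (w + 1))

/-- item stmt-MatrixMultiplication-16312 · support · rank 9 · closed · proved by Summit.MatrixMultiplication.MatrixMultiplication.Theorems.concavityDominates_proof @ 0b8937125bd0 (prover) · by planner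
sources: LandsbergGCT2017
[support] TowerConcavity → SecondColumnDominates (induction on w; proved in the planner's
Sketch.lean). [difficulty: provable-now] -/
@[route_item "route-MatrixMultiplication-MarginalColumns"]
def ConcavityDominates : Prop :=
  TowerConcavity → SecondColumnDominates

/-- item stmt-MatrixMultiplication-16313 · support · rank 9 · open · by planner
sources: LandsbergMichalek2018, ConnerHarperLandsberg2023
[support] the asymptotic content of D ∧ C and the fallback thesis if D dies at one cell: each of the
first n columns costs n^{1+o(1)} — for every ε > 0 there is C with bR⟨n,n,w⟩ ≤ n² + C·w·n^{1+ε} for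
all 1 ≤ w ≤ n. Strictly finer than ω = 2 in the thin regime (blocking from ω = 2 gives only C n²
w^ε); implies EPRFaces' perfect amortisation E. [difficulty: open-problem] -/
@[route_item "route-MatrixMultiplication-MarginalColumns"]
def UniformAmortisation : Prop :=
  ∀ ε : ℝ, 0 < ε → ∃ C : ℝ, ∀ n w : ℕ, 1 ≤ n → 1 ≤ w → w ≤ n → (Literature.Computability.AlgebraicComplexity.algBorderRank (Literature.Computability.AlgebraicComplexity.matMulTensor ℂ n n w) : ℝ) ≤ (n : ℝ) ^ 2 + C * (w : ℝ) * (n : ℝ) ^ (1 + ε)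

/-- item stmt-MatrixMultiplication-16314 · support · rank 9 · closed · proved by Summit.MatrixMultiplication.MatrixMultiplication.Theorems.amortisationOfCruxes_proof @ 2c6605b9dc37 (prover) · by planner
sources: LandsbergGCT2017
[support] SecondColumnDominates → SecondColumnCheap → UniformAmortisation (the tower bound T_n(w) ≤
n² + (w−1)(T_n(2) − n²); proved in the planner's Sketch.lean). [difficulty: provable-now] -/
@[route_item "route-MatrixMultiplication-MarginalColumns"]
def AmortisationOfCruxes : Prop :=
  SecondColumnDominates → SecondColumnCheap → UniformAmortisation

/-- item stmt-MatrixMultiplication-16315 · support · rank 9 · closed · proved by Summit.MatrixMultiplication.MatrixMultiplication.Theorems.cubeNineteenOfDominates_proof @ 954330474690 (prover) · by planner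
sources: Smirnov2013, ConnerHarperLandsberg2023
[support] D → bR⟨3,3,3⟩ ≤ 19 (D at n = 3, w = 2 with the tree's bR⟨3,2,3⟩ ≤ 14 rotated and 9 ≤
bR⟨3,3,1⟩; proved in the planner's Sketch.lean) — records that bR⟨3,3,3⟩ = 20 refutes D.
[difficulty: provable-now] -/
@[route_item "route-MatrixMultiplication-MarginalColumns"]
def CubeNineteenOfDominates : Prop :=
  SecondColumnDominates → Literature.Computability.AlgebraicComplexity.algBorderRank (Literature.Computability.AlgebraicComplexity.matMulTensor ℂ 3 3 3) ≤ 19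

/-- item stmt-MatrixMultiplication-16316 · support · rank 9 · closed · proved by Summit.MatrixMultiplication.MatrixMultiplication.Theorems.twoTowerAffine_proof @ 53fdbb872aa2 (prover) · by planner
sources: LandsbergGCT2017, LandsbergRyder2015, Smirnov2015
[support] D → bR⟨2,2,w⟩ ≤ 3w + 1 for all w ≥ 1 — the sibling tower's expected law (LandsbergGCT2017
§4.8, LandsbergRyder2015 §3) is D at n = 2 (from bR⟨2,2,2⟩ ≤ 7, Strassen, in tree; proved in the
planner's Sketch.lean). [difficulty: provable-now] -/
@[route_item "route-MatrixMultiplication-MarginalColumns"]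
def TwoTowerAffine : Prop :=
  SecondColumnDominates → ∀ w : ℕ, 1 ≤ w → Literature.Computability.AlgebraicComplexity.algBorderRank (Literature.Computability.AlgebraicComplexity.matMulTensor ℂ 2 2 w) ≤ 3 * w + 1

/-- item stmt-MatrixMultiplication-16317 · support · rank 9 · open · by planner
sources: ConnerHarperLandsberg2023, LandsbergMichalek2018
[support] the negative side of C (bulk-only economy): there is c > 0 with bR⟨n,n,2⟩ ≥ (1 + c)n² for
all large n — an all-n border-apolarity target for ⟨2,n,n⟩ in the style of ConnerHarperLandsberg2023
Thm 1.4(3); it refutes C and the route (not the summit). [difficulty: open-problem] -/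
@[route_item "route-MatrixMultiplication-MarginalColumns"]
def SecondColumnGrowth : Prop :=
  ∃ c : ℝ, 0 < c ∧ ∃ n₀ : ℕ, ∀ n : ℕ, n₀ ≤ n → (1 + c) * (n : ℝ) ^ 2 ≤ (Literature.Computability.AlgebraicComplexity.algBorderRank (Literature.Computability.AlgebraicComplexity.matMulTensor ℂ n n 2) : ℝ)

/-- item stmt-MatrixMultiplication-8008 · support · rank 9 · open · by planner
sources: Smirnov2013, ConnerHarperLandsberg2023, LandsbergGCT2017
[crux] bR(⟨3,3,3⟩) ≤ 19 over ℂ[ε] (card C2; format 9×9×9). Window [17,20]: 17 by border apolarity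
(ConnerHarperLandsberg2023), 20 by Smirnov2013 (numerical then exact), 21 = Schönhage's order-2
pattern (BCS Ex. 15.8). Engine: patterns of order h ≤ 2 with a stabiliser of order ≥ 3 in (S_3 ≀
transpose/cyclic) × torus — the border analogue of the symmetric-scheme searches; a 19 reads ω ≤
log_27 19³ = 2.68 and is the first movement at 3×3 since 2013. [deps: TwoSquaresThirteen]
[difficulty: open-problem] -/
@[route_item "route-MatrixMultiplication-MarginalColumns"]
def CubeNineteen : Prop :=
  Literature.Computability.AlgebraicComplexity.algBorderRank (Literature.Computability.AlgebraicComplexity.matMulTensor ℂ 3 3 3) ≤ 19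

/-- item stmt-MatrixMultiplication-16318 · assembly · rank 1 · open · by planner
sources: Bini1980, Blaser2013
[assembly] SecondColumnDominates → SecondColumnCheap → MatrixMultiplication. -/
@[route_item "route-MatrixMultiplication-MarginalColumns"]
def Assembly : Prop :=
  SecondColumnDominates → SecondColumnCheap → _root_.MatrixMultiplication

/-! D-0027 §2.1 — DECIDING THEOREM (planner-authored via `route open/edit --closes-file`; by planner-rrepair-MatrixMultiplication-MarginalC-d4762529-0 2026-08-16T16:48:59Z):
its hypotheses are this route's items and its conclusion the sub-problem Statement (glue_lint), and it elaborates with this file. -/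

@[closes "route-MatrixMultiplication-MarginalColumns"] theorem closes (hD : SecondColumnDominates) (hC : SecondColumnCheap) : _root_.MatrixMultiplication := by
  -- Notation: T w := bR⟨n,n,w⟩ = algBorderRank (matMulTensor ℂ n n w), the column tower of the square format.
  -- Imports used (all PROVED in tree): SchoenhageTau (algBorderRank, algBorderRank_le_tensorRank),
  -- MatrixMultiplicationExponent (matMulTensor, tensorRank_matMulTensor_le, omega), FlatteningBound
  -- (omega_two_le, linearIndependent_rotate_matMulTensor), BorderRankFlattening
  -- (card_le_algBorderRank_of_linearIndependent, algBorderRank_rotate), SchoenhageTauBini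
  -- (Blaser2013_thm66_holds = Bini's theorem, a discharged named fact).
  -- Step 0: the flattening (conciseness) bound n·n ≤ bR⟨n,n,w⟩ for w ≥ 1.
  have flat : ∀ n w : ℕ, 1 ≤ w →
      n * n ≤ Literature.Computability.AlgebraicComplexity.algBorderRank (Literature.Computability.AlgebraicComplexity.matMulTensor ℂ n n w) := by
    intro n w hw
    haveI : NeZero w := ⟨by omega⟩
    have h := Literature.Computability.AlgebraicComplexity.card_le_algBorderRank_of_linearIndependent _
      (Literature.Computability.AlgebraicComplexity.linearIndependent_rotate_matMulTensor ℂ n n w)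
    rw [Literature.Computability.AlgebraicComplexity.algBorderRank_rotate] at h
    simpa [Fintype.card_prod, Fintype.card_fin] using h
  -- Step 1 (ℕ, induction on w from SecondColumnDominates): T w + (w-1)·T 1 ≤ T 1 + (w-1)·T 2.
  have marginal_le : ∀ {n : ℕ}, 1 ≤ n → ∀ w : ℕ, 1 ≤ w →
      Literature.Computability.AlgebraicComplexity.algBorderRank (Literature.Computability.AlgebraicComplexity.matMulTensor ℂ n n w)
        + (w - 1) * Literature.Computability.AlgebraicComplexity.algBorderRank (Literature.Computability.AlgebraicComplexity.matMulTensor ℂ n n 1)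
      ≤ Literature.Computability.AlgebraicComplexity.algBorderRank (Literature.Computability.AlgebraicComplexity.matMulTensor ℂ n n 1)
        + (w - 1) * Literature.Computability.AlgebraicComplexity.algBorderRank (Literature.Computability.AlgebraicComplexity.matMulTensor ℂ n n 2) := by
    intro n hn w hw
    induction w with
    | zero => omega
    | succ w ih =>
      rcases Nat.lt_or_ge w 1 with h0 | h1
      · interval_cases w
        simp
      · have ih' := ih h1
        have hd := hD n w hn h1
        have e1 : w + 1 - 1 = (w - 1) + 1 := by omega
        rw [e1]
        nlinarith [ih', hd]
  -- Step 2: T 1 = n² (flattening below, standard algorithm above).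
  have tower_one : ∀ n : ℕ, Literature.Computability.AlgebraicComplexity.algBorderRank (Literature.Computability.AlgebraicComplexity.matMulTensor ℂ n n 1) = n ^ 2 := by
    intro n
    refine le_antisymm ?_ ?_
    · calc Literature.Computability.AlgebraicComplexity.algBorderRank (Literature.Computability.AlgebraicComplexity.matMulTensor ℂ n n 1)
          ≤ Literature.Computability.AlgebraicComplexity.tensorRank (Literature.Computability.AlgebraicComplexity.matMulTensor ℂ n n 1) :=
            Literature.Computability.AlgebraicComplexity.algBorderRank_le_tensorRank _
        _ ≤ n * n * 1 := Literature.Computability.AlgebraicComplexity.tensorRank_matMulTensor_le ℂ n n 1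
        _ = n ^ 2 := by ring
    · simpa [sq] using flat n 1 le_rfl
  -- Step 3 (ℝ): T w ≤ n² + (w-1)(T 2 − n²).
  have tower_real : ∀ {n w : ℕ}, 1 ≤ n → 1 ≤ w →
      (Literature.Computability.AlgebraicComplexity.algBorderRank (Literature.Computability.AlgebraicComplexity.matMulTensor ℂ n n w) : ℝ) ≤
        (n : ℝ) ^ 2 + ((w : ℝ) - 1) * ((Literature.Computability.AlgebraicComplexity.algBorderRank (Literature.Computability.AlgebraicComplexity.matMulTensor ℂ n n 2) : ℝ) - (n : ℝ) ^ 2) := by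
    intro n w hn hw
    have h := marginal_le hn w hw
    rw [tower_one] at h
    have h' : ((Literature.Computability.AlgebraicComplexity.algBorderRank (Literature.Computability.AlgebraicComplexity.matMulTensor ℂ n n w) + (w - 1) * n ^ 2 : ℕ) : ℝ)
        ≤ ((n ^ 2 + (w - 1) * Literature.Computability.AlgebraicComplexity.algBorderRank (Literature.Computability.AlgebraicComplexity.matMulTensor ℂ n n 2) : ℕ) : ℝ) := by
      exact_mod_cast h
    push_cast [Nat.cast_sub hw] at h'
    nlinarith [h']
  -- Step 4a (Bini, from the discharged fact Blaser2013_thm66): n^ω ≤ bR⟨n,n,n⟩ for n ≥ 2.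
  have bini : ∀ n : ℕ, 2 ≤ n → (n : ℝ) ^ (Literature.Computability.AlgebraicComplexity.omega ℂ)
      ≤ (Literature.Computability.AlgebraicComplexity.algBorderRank (Literature.Computability.AlgebraicComplexity.matMulTensor ℂ n n n) : ℝ) := by
    intro n hn
    have hn0 : (0 : ℝ) < n := by exact_mod_cast (by omega : 0 < n)
    set r : ℕ := Literature.Computability.AlgebraicComplexity.algBorderRank (Literature.Computability.AlgebraicComplexity.matMulTensor ℂ n n n) with hr
    have hflat : n * n ≤ r := flat n n (by omega)
    have hnn : 1 ≤ n * n := by nlinarith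
    have hr1 : 1 ≤ r := hnn.trans hflat
    have h2 : 2 ≤ n * n * n := by nlinarith
    have hB := Literature.Computability.AlgebraicComplexity.Blaser2013_thm66_holds ℂ n n n r h2 hr1 le_rfl
    have hb1 : (1 : ℝ) < ((n * n * n : ℕ) : ℝ) := by exact_mod_cast (by omega : 1 < n * n * n)
    have hr0 : (0 : ℝ) < (r : ℝ) := by exact_mod_cast hr1
    have hdiv : Literature.Computability.AlgebraicComplexity.omega ℂ / 3
        ≤ Real.logb ((n * n * n : ℕ) : ℝ) (r : ℝ) := by linarith
    have hcube : ((n * n * n : ℕ) : ℝ) ^ (Literature.Computability.AlgebraicComplexity.omega ℂ / 3)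
        = (n : ℝ) ^ (Literature.Computability.AlgebraicComplexity.omega ℂ) := by
      have e3 : ((n * n * n : ℕ) : ℝ) = (n : ℝ) ^ (3 : ℝ) := by
        push_cast
        rw [show (3 : ℝ) = ((3 : ℕ) : ℝ) by norm_num, Real.rpow_natCast]
        ring
      rw [e3, ← Real.rpow_mul hn0.le]
      congr 1
      ring
    calc (n : ℝ) ^ (Literature.Computability.AlgebraicComplexity.omega ℂ)
        = ((n * n * n : ℕ) : ℝ) ^ (Literature.Computability.AlgebraicComplexity.omega ℂ / 3) := hcube.symm
      _ ≤ ((n * n * n : ℕ) : ℝ) ^ (Real.logb ((n * n * n : ℕ) : ℝ) (r : ℝ)) :=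
          Real.rpow_le_rpow_of_exponent_le hb1.le hdiv
      _ = (r : ℝ) := Real.rpow_logb (by linarith) (ne_of_gt hb1) hr0
  -- Step 4b: ω ≤ 2 + ε for every ε > 0, from Bini and the cheap second column.
  have hle : Literature.Computability.AlgebraicComplexity.omega ℂ ≤ 2 := by
    refine le_of_forall_pos_lt_add fun ε hε => ?_
    obtain ⟨C, hCn⟩ := hC (ε / 2) (half_pos hε)
    set C' : ℝ := max C 0 with hC'
    have hC'0 : 0 ≤ C' := le_max_right _ _
    have key : ∀ n : ℕ, 2 ≤ n → (n : ℝ) ^ (Literature.Computability.AlgebraicComplexity.omega ℂ) ≤ (1 + C') * (n : ℝ) ^ (2 + ε / 2) := by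
      intro n hn
      have hn1' : 1 ≤ n := by omega
      have hn0 : (0 : ℝ) < n := by exact_mod_cast (by omega : 0 < n)
      have hn1 : (1 : ℝ) ≤ n := by exact_mod_cast hn1'
      have hlow := bini n hn
      have hup := tower_real hn1' hn1'
      have h2 := hCn n hn1'
      have hT2 : (Literature.Computability.AlgebraicComplexity.algBorderRank (Literature.Computability.AlgebraicComplexity.matMulTensor ℂ n n 2) : ℝ) - (n : ℝ) ^ 2
          ≤ C' * (n : ℝ) ^ (1 + ε / 2) := by
        have : C * (n : ℝ) ^ (1 + ε / 2) ≤ C' * (n : ℝ) ^ (1 + ε / 2) :=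
          mul_le_mul_of_nonneg_right (le_max_left _ _) (Real.rpow_nonneg hn0.le _)
        linarith
      have hw1 : (0 : ℝ) ≤ (n : ℝ) - 1 := by linarith
      have hmul : ((n : ℝ) - 1) * ((Literature.Computability.AlgebraicComplexity.algBorderRank (Literature.Computability.AlgebraicComplexity.matMulTensor ℂ n n 2) : ℝ) - (n : ℝ) ^ 2)
          ≤ ((n : ℝ) - 1) * (C' * (n : ℝ) ^ (1 + ε / 2)) := mul_le_mul_of_nonneg_left hT2 hw1
      have hpow : (n : ℝ) ^ 2 ≤ (n : ℝ) ^ (2 + ε / 2) := by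
        rw [show (n : ℝ) ^ 2 = (n : ℝ) ^ ((2 : ℕ) : ℝ) by rw [Real.rpow_natCast]]
        exact Real.rpow_le_rpow_of_exponent_le hn1 (by norm_num; linarith)
      have hpow' : ((n : ℝ) - 1) * (C' * (n : ℝ) ^ (1 + ε / 2)) ≤ C' * (n : ℝ) ^ (2 + ε / 2) := by
        have e : (n : ℝ) ^ (2 + ε / 2) = (n : ℝ) * (n : ℝ) ^ (1 + ε / 2) := by
          rw [show (2 + ε / 2) = 1 + (1 + ε / 2) by ring, Real.rpow_add hn0, Real.rpow_one]
        rw [e]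
        have : 0 ≤ C' * (n : ℝ) ^ (1 + ε / 2) := mul_nonneg hC'0 (Real.rpow_nonneg hn0.le _)
        nlinarith
      calc (n : ℝ) ^ (Literature.Computability.AlgebraicComplexity.omega ℂ)
          ≤ (Literature.Computability.AlgebraicComplexity.algBorderRank (Literature.Computability.AlgebraicComplexity.matMulTensor ℂ n n n) : ℝ) := hlow
        _ ≤ (n : ℝ) ^ 2 + ((n : ℝ) - 1) * ((Literature.Computability.AlgebraicComplexity.algBorderRank (Literature.Computability.AlgebraicComplexity.matMulTensor ℂ n n 2) : ℝ) - (n : ℝ) ^ 2) := hup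
        _ ≤ (n : ℝ) ^ (2 + ε / 2) + C' * (n : ℝ) ^ (2 + ε / 2) := by linarith
        _ = (1 + C') * (n : ℝ) ^ (2 + ε / 2) := by ring
    by_contra hlt
    push Not at hlt
    have hδ : 0 < Literature.Computability.AlgebraicComplexity.omega ℂ - (2 + ε / 2) := by linarith
    have hev : ∀ n : ℕ, 2 ≤ n → (n : ℝ) ^ (Literature.Computability.AlgebraicComplexity.omega ℂ - (2 + ε / 2)) ≤ 1 + C' := by
      intro n hn
      have hn0 : (0 : ℝ) < n := by exact_mod_cast (by omega : 0 < n)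
      rw [Real.rpow_sub hn0, div_le_iff₀ (Real.rpow_pos_of_pos hn0 _)]
      exact key n hn
    have hlim : Filter.Tendsto (fun n : ℕ => (n : ℝ) ^ (Literature.Computability.AlgebraicComplexity.omega ℂ - (2 + ε / 2))) Filter.atTop Filter.atTop :=
      (tendsto_rpow_atTop hδ).comp tendsto_natCast_atTop_atTop
    obtain ⟨n, hn⟩ := ((hlim.eventually_gt_atTop (1 + C')).and (Filter.eventually_ge_atTop 2)).exists
    exact absurd (hev n hn.2) (not_le.2 hn.1)
  -- Step 5: 2 ≤ ω (flattening, tree) and the unfolding MatrixMultiplication ↔ ω(ℂ) = 2.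
  exact (_root_.MatrixMultiplication_iff).2
    (le_antisymm hle (Literature.Computability.AlgebraicComplexity.omega_two_le ℂ))

end Summit.MatrixMultiplication.MatrixMultiplication.Theses.MarginalColumns
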